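import Summits.BirchSwinnertonDyer.Rank1Residual.Additive.SplitMultiplicativeWitnessKodairaNeronLocal
import Summits.BirchSwinnertonDyer.Rank1Residual.Additive.SplitMultiplicativeWitnessOfTamagawa
import HarnessLib

/-!
# The split-multiplicative Tamagawa witness WITHOUT Tate's uniformisation
# (cell `b2b-bsdres`, team n1011, seat p01 GEN 4; row T-L1-KN2 FILE 2, sequel of T-L1-KN;
# consumers: n1011-p10's MAIN `budgetLeLambdaAt_layer_of_certificates` and budget sockets
# `hwit` / `hwitn`, n1011-p16's T-BUD5-K lineage)

HONEST FRAMING (cell `b2b-bsdres`, run/shared/lean/b2b/bsd-rank1-residual/, verbatim in every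
file): the goal of the cell is to DELETE the COMBINATION-SHAPED residual classes of the
Birch–Swinnerton-Dyer formula for ALL analytic-rank `≤ 1` elliptic curves over `ℚ` — "full BSD
formula for every rank `≤ 1` curve in class `C`" assembled STRICTLY from published theorems — so
that the rank-`≤ 1` remainder becomes exactly the CONSTRUCTION-SHAPED classes, which are TYPED
(missing-input `Prop`s), NOT attempted. This is not "finishing BSD". Team n1011 (N10 / N11, the
Route-G budget node): research route; no claim beyond the stated classes; nothing is booked; marks
UNCHANGED. THEOREMS ONLY: no definition, no named fact, no `sorry`, NO named-fact hypothesis —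
everything in this file is unconditional.

## What

Row T-L1-KN (this seat, gen 3, `SplitMultiplicativeWitnessOfTamagawa.lean`) left n1011-p10's
per-place binder `hwitn` — `∃ u ∈ H¹_ur(K_v, E[p]), u ∉ 𝓚_v` at every split multiplicative `v ∤ p`
with `p ∣ c_v` — conditional on the named fact `Silverman1994_thmV53_tateUniformisation` (A40,
hypothesis `hU`), because the arithmetic step "some `P ∈ E(K_v)` has NO inertia-fixed `p`-th root"
came from n1011-p16's TATE route (`exists_point_forall_root_not_fixed_of_tateData`). FILE 1
(`SplitMultiplicativeWitnessKodairaNeronLocal.lean`) proves that step on the integral minimal model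
from Kodaira–Néron over `K_v^nr`, WITHOUT the Tate curve; this file transports it to `E/K` and
deletes `hU` everywhere downstream:

* §2 `exists_point_forall_absInertia_not_fixed_of_hasSplitMultiplicativeReductionAt_of_dvd` — for
  `E/K` elliptic over a number field, `v` split multiplicative, `p ∣ ord_v(Δ_min)`:
  `∃ P ∈ E(K_v)`, every `Q ∈ E(K̄_v)` with `p • Q = P` is moved by some `τ ∈ absInertia K_v` —
  LITERALLY the hypothesis `hP` of n1011-p16's
  `exists_mem_unramifiedSubgroup_not_mem_kummerLocalConditionAt_of_forall_root` (FILE 1 on the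
  integral minimal model `X₀` at `v`, where `[X₀(K_v) : E₀] = c_v = ord_v(Δ_min)` by the tree's
  `localTamagawaNumber_eq_ordMinimalDiscriminant_of_hasSplitMultiplicativeReductionAt`; transport
  `exists_addEquiv_localPoints_of_smul_eq`, Galois descent `exists_toGeomPoints_eq_of_forall_smul_eq`,
  `inertia_eq_absInertia`).
* §3 `exists_mem_unramifiedSubgroup_not_mem_kummerLocalConditionAt_of_split_of_dvd_localTamagawaNumber`
  — **for `E` over ANY number field `K`, `p` prime, `v ∤ p` split multiplicative with `p ∣ c_v`:
  `∃ u ∈ H¹_ur(K_v, E[p])`, `u ∉ 𝓚_v`, with NO hypothesis `hU`** (gen 3's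
  `…_of_tateUniformisation_of_split_of_dvd_localTamagawaNumber` minus A40).
* §4 `exists_mem_unramifiedSubgroup_not_mem_kummerLocalConditionAt_baseChange_of_split_of_dvd_localTamagawaNumber_kodairaNeron`
  (+ primed twin, `𝔭.under (𝓞 ℚ) = v`) — **the level-`K` witness from the census datum OVER `ℚ`**
  (`V/ℚ` globally minimal, `v ∤ p` split multiplicative, `p ∣ c_v(V/ℚ)`, `K` ANY number field,
  `𝔭 ∣ v`), i.e. gen 3's two base-change forms with `hU` DELETED: n1011-p10's `hwitn` / the split
  disjunct of `exists_mem_unramifiedSubgroup_not_mem_kummerLocalConditionAt_layer_of_tamagawaRow`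
  at `K := κ.layer n`, `𝔭 := w`, now needing no named fact. Consequently `hU` can be dropped from
  `budgetLeLambdaAt_layer_of_certificates` / `…_of_hres` / `residualSelmerRankGeAt_layer_of_certificates`
  (`BudgetFromTamagawaCertificatesLayerAll.lean`), whose remaining named inputs are Greenberg
  Prop. 4.14, Poitou–Tate duality and the local Euler–Poincaré formula over `ℚ_n`.

HONEST LIMITS: split multiplicative places only (at a non-split multiplicative place `c_v ∈ {1, 2}`
carries no odd-`p` datum; additive places are n1011-p06's `AdditiveTamagawaWitness*`, already
fact-free); nothing here about Greenberg 4.14 / Poitou–Tate / Euler–Poincaré; A40 remains an input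
of other files of the cell (the (M)-locus Kummer-line files, X2, visibility) — untouched.

References: J. H. Silverman, *ATAEC*, GTM 151 (1994), Cor. IV.9.2 (d) (PDF p. 340 of the held
copy); J. H. Silverman, *AEC*, 2nd ed. (2009), VII.1.3, VII.2.1, VIII.§1; R. Greenberg, LNM 1716
(1999), §3 p. 74 and the proof of Cor. 5.6; J. S. Milne, *Arithmetic Duality Theorems* (2006),
I Lemma 2.9, Lemma 3.3.

## Design

Theorems only; `noncomputable section`; `open scoped Classical NNReal NumberField`; `K : Type`
as in gen 3's lemmas and the consumers (`κ.layer n : Type`).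
-/

noncomputable section

open scoped Classical NNReal NumberField

open NumberField IsDedekindDomain Field IsLocalRing

namespace Summit.BirchSwinnertonDyer.Rank1Residual.Additive

open Literature.NumberTheory.EllipticCurves Literature.NumberTheory.EllipticCurves.LocalIndex
  Literature.NumberTheory.GaloisRepresentations
  Literature.NumberTheory.GaloisRepresentations.IsNonarchimedeanLocalField
  Literature.NumberTheory.DiophantineGeometry Literature.NumberTheory.DiophantineGeometry.TateAlgorithm
  IsDedekindDomain.HeightOneSpectrum Rat.HeightOneSpectrum WeierstrassCurve

/-! ## §2 The theorem for an elliptic curve over a number field at a split multiplicative place -/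

section NumberField

variable {K : Type} [Field K] [NumberField K] (W : WeierstrassCurve K) [W.IsElliptic]
  {p : ℕ} [hp : Fact p.Prime] (v : HeightOneSpectrum (𝓞 K))

/-- **At a split multiplicative place with `p ∣ ord_v(Δ_min)` some rational point has NO
inertia-fixed `p`-th root — from Kodaira–Néron, without Tate's uniformisation.** Let `E = W` be an
elliptic curve over a number field `K`, `v` a finite place of SPLIT multiplicative reduction and `p`
a prime with `p ∣ ord_v(Δ_min) = c_v`. Then there is a `K_v`-rational point `P` (read in `E(K̄_v)`
through `e = baseChangeGeomPointsEquiv`) such that EVERY `Q ∈ E(K̄_v)` with `p • Q = e(P)` is moved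
by some element of the inertia group `absInertia K_v` — literally the hypothesis `hP` of
n1011-p16's `exists_mem_unramifiedSubgroup_not_mem_kummerLocalConditionAt_of_forall_root`
(`KummerVersusUnramifiedLocal.lean`), which p16's `exists_point_forall_root_not_fixed_of_tateData`
supplied from TATE DATA. Proof: the local theorem
`exists_point_forall_exists_inertia_map_ne_of_multiplicative_of_dvd_of_index` on the integral
minimal model `X₀` at `v` (`c₄ ∈ 𝓞_v^×`, `Δ = α π^m`, `m = ord_v(Δ_min)`, and
`[X₀(K_v) : E₀] = c_v = m` by the tree's
`localTamagawaNumber_eq_ordMinimalDiscriminant_of_hasSplitMultiplicativeReductionAt`), transported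
along `E(K̄_v) ≃ X₀(K̄_v)` (`exists_addEquiv_localPoints_of_smul_eq`) and Galois descent
(`exists_toGeomPoints_eq_of_forall_smul_eq`); `I_𝔐 = absInertia K_v` (`inertia_eq_absInertia`).
[cite: SilvermanATAEC1994, Cor. IV.9.2(d) (PDF p. 340)] [cite: GreenbergLNM1716, §3 p. 74]
[cite: SilvermanAEC2009, VII.2 Prop. 2.1 and VIII.§1] -/
theorem exists_point_forall_absInertia_not_fixed_of_hasSplitMultiplicativeReductionAt_of_dvd
    (hsplit : W.HasSplitMultiplicativeReductionAt v) (hdvd : p ∣ W.ordMinimalDiscriminant v) :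
    ∃ P : (W.baseChange (v.adicCompletion K)).toAffine.Point,
      ∀ Q : localPoints W (v.adicCompletion K),
        (p : ℤ) • Q = W.baseChangeGeomPointsEquiv (v.adicCompletion K)
            (toGeomPoints (W.baseChange (v.adicCompletion K)) P) →
          ∃ τ ∈ absInertia (v.adicCompletion K), τ • Q ≠ Q := by
  haveI : CharZero (v.adicCompletion K) :=
    charZero_of_injective_algebraMap (algebraMap K (v.adicCompletion K)).injective
  obtain ⟨w, hw⟩ := v.exists_spectralValuation
  obtain ⟨𝔐, h𝔐⟩ := v.localPrimesAbove_nonempty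
  -- the integral minimal model `X₀` at `v`
  set X := W.localMinimalModel v with hXdef
  haveI : X.IsElliptic := W.isElliptic_localMinimalModel v
  have hmult' : X.HasMultiplicativeReduction (v.adicCompletionIntegers K) :=
    hsplit.hasMultiplicativeReductionAt
  set X₀ : WeierstrassCurve (v.adicCompletionIntegers K) :=
    X.integralModel (v.adicCompletionIntegers K) with hX₀
  have hX₀X : X₀.baseChange (v.adicCompletion K) = X :=
    baseChange_integralModel_eq (v.adicCompletionIntegers K) X
  -- `Δ(X₀) ∈ 𝔪_v`, `c₄(X₀) ∈ 𝓞_v^×`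
  have hΔm : X₀.Δ ∈ IsLocalRing.maximalIdeal (v.adicCompletionIntegers K) := by
    have h := hmult'.badReduction
    rw [← integralModel_Δ_eq (v.adicCompletionIntegers K) X] at h
    exact (valuation_lt_one_iff_mem _ _).mp h
  have hc₄ : X₀.c₄ ∉ IsLocalRing.maximalIdeal (v.adicCompletionIntegers K) := by
    have h := hmult'.multiplicativeReduction
    rw [← integralModel_c₄_eq (v.adicCompletionIntegers K) X, valuation_of_algebraMap] at h
    exact intValuation_eq_one_iff.mp h
  -- `Δ(X₀) = α π^m`, `m = ord_v(Δ_min) ≥ 1`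
  obtain ⟨π, hπ⟩ := IsDiscreteValuationRing.exists_irreducible (v.adicCompletionIntegers K)
  have hΔ0 : X₀.Δ ≠ 0 := by
    intro h0
    apply X.isUnit_Δ.ne_zero
    rw [← hX₀X]
    change (X₀.map _).Δ = 0
    rw [map_Δ, h0, map_zero]
  obtain ⟨m, α, hα⟩ := IsDiscreteValuationRing.eq_unit_mul_pow_irreducible hΔ0 hπ
  have hm : W.ordMinimalDiscriminant v = m := by
    change (IsDiscreteValuationRing.addVal (v.adicCompletionIntegers K) X₀.Δ).toNat = m
    rw [IsDiscreteValuationRing.addVal_def X₀.Δ α hπ m hα]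
    rfl
  have hm1 : 1 ≤ m := by
    rcases Nat.eq_zero_or_pos m with h0 | hpos
    · exfalso
      rw [h0, pow_zero, mul_one] at hα
      rw [hα] at hΔm
      exact (IsLocalRing.mem_maximalIdeal _).mp hΔm α.isUnit
    · exact hpos
  -- SPLIT: `[X₀(K_v) : E₀] = c_v = ord_v(Δ_min) = m`
  have hidx : (X₀.nonsingularReductionSubgroup (integers_valuationRing_valuation
      (v.adicCompletionIntegers K) (v.adicCompletion K))).index = m := by
    rw [← index_goodReductionSubgroup_eq_of_baseChange_eq X X₀ hX₀X, ← hm,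
      ← localTamagawaNumber_eq_ordMinimalDiscriminant_of_hasSplitMultiplicativeReductionAt v W
        hsplit]
    rfl
  rw [hm] at hdvd
  obtain ⟨P₀, hP₀⟩ :=
    exists_point_forall_exists_inertia_map_ne_of_multiplicative_of_dvd_of_index hw X₀ α.isUnit hπ
      hm1 hα hc₄ hp.out hdvd hidx h𝔐
  -- transport `E(K̄_v) ≃ X₀(K̄_v)`
  obtain ⟨C, hC⟩ := W.exists_variableChange_smul_eq_localMinimalModel v
  have hC' : C • W.baseChange (v.adicCompletion K) = X₀.baseChange (v.adicCompletion K) := by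
    rw [hC, hX₀X]
  obtain ⟨Φ, hΦ⟩ := W.exists_addEquiv_localPoints_of_smul_eq v hC'
  set ιX : (X₀.baseChange (v.adicCompletion K)).toAffine.Point →+
      ((X₀.baseChange (v.adicCompletion K)).baseChange
        (AlgebraicClosure (v.adicCompletion K))).toAffine.Point :=
    WeierstrassCurve.Affine.Point.map (W' := X₀.baseChange (v.adicCompletion K))
      (Algebra.ofId (v.adicCompletion K) (AlgebraicClosure (v.adicCompletion K))) with hιX
  -- the rational point, read in `E(K̄_v)`, is `Γ_{K_v}`-fixed, hence comes from `E(K_v)`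
  set P₁ : localPoints W (v.adicCompletion K) := Φ.symm (ιX P₀) with hP₁
  have hP₁fix : ∀ σ : absoluteGaloisGroup (v.adicCompletion K), σ • P₁ = P₁ := fun σ ↦ by
    apply Φ.injective
    rw [hΦ, hP₁, AddEquiv.apply_symm_apply, hιX]
    exact WeierstrassCurve.Affine.Point.map_baseChange (W' := X₀.baseChange (v.adicCompletion K))
      _ P₀
  set P₂ : geomPoints (W.baseChange (v.adicCompletion K)) :=
    (W.baseChangeGeomPointsEquiv (v.adicCompletion K)).symm P₁ with hP₂
  have hP₂fix : ∀ σ : absoluteGaloisGroup (v.adicCompletion K), σ • P₂ = P₂ := fun σ ↦ by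
    apply (W.baseChangeGeomPointsEquiv (v.adicCompletion K)).injective
    rw [W.baseChangeGeomPointsEquiv_smul, hP₂, AddEquiv.apply_symm_apply, hP₁fix]
  obtain ⟨P, hP⟩ := exists_toGeomPoints_eq_of_forall_smul_eq
    (W := W.baseChange (v.adicCompletion K)) hP₂fix
  refine ⟨P, fun Q hQ ↦ ?_⟩
  rw [hP, hP₂, AddEquiv.apply_symm_apply] at hQ
  by_contra hall
  push Not at hall
  -- `Φ Q` is an inertia-fixed `p`-th root of `P₀` in `X₀(K̄_v)`
  have hΦQ : p • Φ Q = ιX P₀ := by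
    rw [← map_nsmul, ← natCast_zsmul, hQ, hP₁, AddEquiv.apply_symm_apply]
  obtain ⟨σ, hσ, hne⟩ := hP₀ (Φ Q) hΦQ
  rw [IsDedekindDomain.HeightOneSpectrum.inertia_eq_absInertia hw h𝔐] at hσ
  exact hne (by rw [← hΦ, hall σ hσ])

/-! ## §3 The Tamagawa witness at a split multiplicative place, WITHOUT Tate's uniformisation -/

/-- **THE SPLIT-MULTIPLICATIVE TAMAGAWA WITNESS FROM `p ∣ c_v`, UNCONDITIONALLY.** For `E = W`
over ANY number field `K`, `p` prime, `v ∤ p` a place of split multiplicative reduction with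
`p ∣ c_v` (`localTamagawaNumber` of `E ⊗ K_v`): `∃ u ∈ H¹_ur(K_v, E[p])`, `u ∉ 𝓚_v` — the per-place
binder `hwit` / `hwitn` of n1011-p10's budget sockets and the split disjunct of his MAIN
`budgetLeLambdaAt_layer_of_certificates`. This is this seat's gen-3
`…_of_tateUniformisation_of_split_of_dvd_localTamagawaNumber` (`SplitMultiplicativeWitnessOfTamagawa.lean`)
with the hypothesis `hU : Silverman1994_thmV53_tateUniformisation` (named fact A40) GONE: the
rational point with no inertia-fixed `p`-th root now comes from Kodaira–Néron (previous theorem),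
and the cohomological half is n1011-p16's
`exists_mem_unramifiedSubgroup_not_mem_kummerLocalConditionAt_of_forall_root`
(`#H¹_ur(K_v, E[p]) = #𝓚_v` at `v ∤ p`). [cite: GreenbergLNM1716, §3 p. 74 and Cor. 5.6 (proof)]
[cite: SilvermanATAEC1994, Cor. IV.9.2(d) (PDF p. 340)] [cite: MilneADT2006, Ch. I, Lemma 2.9 and Lemma 3.3] -/
theorem exists_mem_unramifiedSubgroup_not_mem_kummerLocalConditionAt_of_split_of_dvd_localTamagawaNumber
    (hsplit : W.HasSplitMultiplicativeReductionAt v) (hpv : ((p : ℕ) : 𝓞 K) ∉ v.asIdeal)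
    (hc : p ∣ (W.baseChange (v.adicCompletion K)).localTamagawaNumber
      (v.adicCompletionIntegers K)) :
    ∃ u ∈ DiscreteGaloisModule.unramifiedSubgroup
        ((W.torsionGaloisModule (p : ℤ)).restrictField (v.adicCompletion K)) 1,
      u ∉ W.kummerLocalConditionAt (p : ℤ) (v.adicCompletion K) := by
  obtain ⟨P, hP⟩ :=
    exists_point_forall_absInertia_not_fixed_of_hasSplitMultiplicativeReductionAt_of_dvd W v hsplit
      (dvd_ordMinimalDiscriminant_of_dvd_localTamagawaNumber W p v hsplit hc)
  exact W.exists_mem_unramifiedSubgroup_not_mem_kummerLocalConditionAt_of_forall_root v hpv P hP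

end NumberField

/-! ## §4 Base change `ℚ → K`: the level-`K` witness from the census datum over `ℚ`, no A40 -/

section BaseChange

variable (V : WeierstrassCurve ℚ) [V.IsElliptic] [V.IsGloballyMinimal] (p : ℕ) [hp : Fact p.Prime]
  {v : HeightOneSpectrum (𝓞 ℚ)} {K : Type} [Field K] [NumberField K]
  (𝔭 : HeightOneSpectrum (𝓞 K))

/-- **THE LEVEL-`K` TAMAGAWA WITNESS FROM THE CENSUS DATUM OVER `ℚ`, UNCONDITIONALLY.** For `V/ℚ`
globally minimal, `p` prime, `v ∤ p` a place of split multiplicative reduction with `p ∣ c_v(V/ℚ)`,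
`K` ANY number field (e.g. a layer `ℚ_n = κ.layer n` of the cyclotomic `ℤ_p`-extension) and `𝔭` a
place of `K` above `v`: `∃ u ∈ H¹_ur(K_𝔭, V[p])`, `u ∉ 𝓚_𝔭` for `V ⊗ K` — n1011-p10's binder
`hwitn` at the split multiplicative Tamagawa places of the layer (consumed at `K := κ.layer n`,
`𝔭 := w` by `Additive/BudgetFromTamagawaCertificatesLayerAll.lean`), now with NO named-fact
hypothesis at all: this seat's gen-3
`…_baseChange_of_split_of_dvd_localTamagawaNumber` minus `hU`. Split multiplicative reduction
persists at `𝔭` (n1011-p16's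
`hasSplitMultiplicativeReductionAt_baseChange_of_hasSplitMultiplicativeReductionAtPrime`) and
`p ∣ c_v(V/ℚ) = ord_v Δ_min(V) ∣ ord_𝔭 Δ_min(V ⊗ K)` (gen 3, Silverman *AEC* VII.1.3 (b)).
[cite: GreenbergLNM1716, §3 p. 74 and Cor. 5.6 (proof)] [cite: SilvermanATAEC1994, Cor. IV.9.2(d) (PDF p. 340)]
[cite: SilvermanAEC2009, VII.1 Prop. 1.3(b), VII.5 Prop. 5.1(b)] -/
theorem exists_mem_unramifiedSubgroup_not_mem_kummerLocalConditionAt_baseChange_of_split_of_dvd_localTamagawaNumber_kodairaNeron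
    (hpv : ((p : ℕ) : 𝓞 ℚ) ∉ v.asIdeal) (hsplit : V.HasSplitMultiplicativeReductionAt v)
    (hc : p ∣ (V.baseChange (v.adicCompletion ℚ)).localTamagawaNumber (v.adicCompletionIntegers ℚ))
    (h𝔭 : 𝔭.asIdeal.under (𝓞 ℚ) = v.asIdeal) :
    ∃ u ∈ DiscreteGaloisModule.unramifiedSubgroup
        (((V.baseChange K).torsionGaloisModule (p : ℤ)).restrictField (𝔭.adicCompletion K)) 1,
      u ∉ (V.baseChange K).kummerLocalConditionAt (p : ℤ) (𝔭.adicCompletion K) := by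
  haveI : Fact (primesEquiv v : ℕ).Prime := ⟨(primesEquiv v).2⟩
  haveI : (V.baseChange K).IsElliptic := by rw [baseChange]; infer_instance
  have hsplitP : V.HasSplitMultiplicativeReductionAtPrime (primesEquiv v : ℕ) :=
    (hasSplitMultiplicativeReductionAtPrime_iff_hasSplitMultiplicativeReductionAt V v).mpr hsplit
  have hℓ𝔭 := natCast_primesEquiv_mem_of_under_eq 𝔭 h𝔭
  have hp𝔭 : ((p : ℕ) : 𝓞 K) ∉ 𝔭.asIdeal := fun h ↦ hpv (by
    rw [← h𝔭, Ideal.mem_comap, map_natCast]; exact h)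
  have hsplitK : (V.baseChange K).HasSplitMultiplicativeReductionAt 𝔭 :=
    hasSplitMultiplicativeReductionAt_baseChange_of_hasSplitMultiplicativeReductionAtPrime V
      (primesEquiv v : ℕ) 𝔭 hℓ𝔭 hsplitP
  have hdvdK : p ∣ (V.baseChange K).ordMinimalDiscriminant 𝔭 :=
    (dvd_ordMinimalDiscriminant_of_dvd_localTamagawaNumber V p v hsplit hc).trans
      (ordMinimalDiscriminant_dvd_ordMinimalDiscriminant_baseChange V 𝔭 hsplit h𝔭)
  obtain ⟨P, hP⟩ :=
    exists_point_forall_absInertia_not_fixed_of_hasSplitMultiplicativeReductionAt_of_dvd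
      (V.baseChange K) 𝔭 hsplitK hdvdK
  exact (V.baseChange K).exists_mem_unramifiedSubgroup_not_mem_kummerLocalConditionAt_of_forall_root
    𝔭 hp𝔭 P hP

/-- The same with the place-level hypothesis `𝔭.under (𝓞 ℚ) = v` (the form of n1011-p10's
`exists_finset_placesOver_card_ge` and of his MAIN's split disjunct). [cite: GreenbergLNM1716, §3 p. 74 and Cor. 5.6 (proof)]
[cite: SilvermanATAEC1994, Cor. IV.9.2(d) (PDF p. 340)] -/
theorem exists_mem_unramifiedSubgroup_not_mem_kummerLocalConditionAt_baseChange_of_split_of_dvd_localTamagawaNumber_kodairaNeron'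
    (hpv : ((p : ℕ) : 𝓞 ℚ) ∉ v.asIdeal) (hsplit : V.HasSplitMultiplicativeReductionAt v)
    (hc : p ∣ (V.baseChange (v.adicCompletion ℚ)).localTamagawaNumber (v.adicCompletionIntegers ℚ))
    (h𝔭 : 𝔭.under (𝓞 ℚ) = v) :
    ∃ u ∈ DiscreteGaloisModule.unramifiedSubgroup
        (((V.baseChange K).torsionGaloisModule (p : ℤ)).restrictField (𝔭.adicCompletion K)) 1,
      u ∉ (V.baseChange K).kummerLocalConditionAt (p : ℤ) (𝔭.adicCompletion K) :=
  exists_mem_unramifiedSubgroup_not_mem_kummerLocalConditionAt_baseChange_of_split_of_dvd_localTamagawaNumber_kodairaNeron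
    V p 𝔭 hpv hsplit hc (by
      have h := congrArg HeightOneSpectrum.asIdeal h𝔭
      rw [HeightOneSpectrum.under_asIdeal] at h
      exact h)

end BaseChange

end Summit.BirchSwinnertonDyer.Rank1Residual.Additive

end
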